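import Summits.QuantumFields.QCD.Theses.QuarksAsStableAction
import Literature.MathematicalPhysics.QuantumLattice.WilsonDiracAP
import Literature.MathematicalPhysics.QuantumFieldTheory.QCDPhaseQuenched
import Literature.Probability.LatticeModels.LatticeAnimalsGraph

/-!
# `UnquenchedChessboardBound` ⇒ the signed Peierls bound for EXACT bad/good patterns
(crux `QuarksAsStableAction.StableActionBridge`, item stmt-QuantumFields-9737, line `Sketch`; lead helper of the
continuation lead, `--supports stmt-QuantumFields-9737`, registered sub-goal
`exact_pattern_bound_of_unquenchedChessboardBound`)

The bridge consumes A = `UnquenchedChessboardBound` through the dilute-dislocation step (route header, TWO-LAYER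
PLAN: "B ⇐ DiluteDislocations (Peierls/percolation from A: bad plaquettes form finite clusters with exponential
size tails, uniformly in k and volume)").  A bounds only the MOMENTS `|⟨∏_{p ∈ R} 1[p bad]⟩|` of the signed,
normalised unquenched functional.  A cluster event, however, is a MIXED pattern — "all of `S` bad AND all of its
boundary `Q` good" — and for a signed (complex) weight the indicator of the good part cannot simply be dropped
(no monotonicity).  What replaces monotonicity is inclusion–exclusion: `1[Q good] = ∏_{q∈Q}(1 − 1[q bad]) =
Σ_{Q'⊆Q} (−1)^{|Q'|} 1[Q' bad]`, so that

`|⟨1[S bad] 1[Q good]⟩| ≤ Σ_{Q' ⊆ Q} |⟨1[(S ∪ Q') bad]⟩| ≤ (C e^{−cβ})^{|S|} (1 + C e^{−cβ})^{|Q|}`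

(`norm_setIntegral_biInter_inter_biInter_compl_le`, abstract, any complex integrable weight on any measure space;
then `exact_pattern_bound_of_unquenchedChessboardBound`, over the route's objects, uniformly in the even volume and
the mass window).  Since a connected plaquette set of size `n` has a boundary of size `≤ c_d n`, this is the
exponential tail of the EXACT-cluster activities that the polymer representation of the dislocation gas needs,
complementing the pure-moment Peierls sum `peierls_sum_of_unquenchedChessboardBound` (p106866).  If `S` and `Q`
meet, the pattern is empty and the bound is trivial; otherwise `|S ∪ Q'| = |S| + |Q'|` and
`Σ_{Q'⊆Q} t^{|Q'|} = (1 + t)^{|Q|}`.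

## Appended (same proposal series): the exact-cluster size tail

Fix any plaquette adjacency `G` of maximal degree `Δ`.  The event "the `G`-connected `δ`-bad component through `p`
is exactly `S`" is the mixed pattern "all of `S` bad, all of the outer boundary `∂_G S = (⋃_{x∈S} N_G(x)) ∖ S`
good".  By the exact-pattern bound each such activity is at most `t^{|S|} (1+t)^{|∂_G S|} ≤ t^{|S|} (1+t)^{Δ|S|}`,
`t = C e^{−cβ}`, and there are at most `Δ^{2(n−1)} ≤ (Δ+1)^{2n}` connected `n`-sets through `p` (the tree's
lattice-animal bound `card_le_pow_of_isGraphConnected`), so the sum over exact clusters of size `n` through `p` is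
at most `(Δ+1)^{2n} tⁿ (1+t)^{Δn} = ((Δ+1)² t (1+t)^Δ)ⁿ` — summable in `n` once `β` is large, uniformly in the even
volume and the mass window (`exact_cluster_sum_of_unquenchedChessboardBound`).
-/

namespace Summit.QuantumFields.QCD.Cruxes.StableActionBridge.Sketch

open MeasureTheory
open Literature.MathematicalPhysics.QuantumLattice Literature.MathematicalPhysics.QuantumFieldTheory
open Summit.QuantumFields.QCD.Theses.QuarksAsStableAction (UnquenchedChessboardBound)
open Literature.Probability.LatticeModels (IsGraphConnected card_le_pow_of_isGraphConnected)

/-! ## Inclusion–exclusion for a signed weight (abstract) -/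

/-- **Signed inclusion–exclusion bound.**  For a complex integrable weight `w`, measurable events `B i` and finite
index sets `S`, `Q`: `‖∫_{(⋂_{i∈S} B i) ∩ ⋂_{i∈Q} (B i)ᶜ} w‖ ≤ Σ_{Q' ⊆ Q} ‖∫_{⋂_{i ∈ S ∪ Q'} B i} w‖`.
(Induction on `Q`: `∫_{E ∖ B_q} w = ∫_E w − ∫_{E ∩ B_q} w`.) [folklore] -/
theorem norm_setIntegral_biInter_inter_biInter_compl_le {α ι : Type*} [MeasurableSpace α]
    {μ : Measure α} [DecidableEq ι] (B : ι → Set α) (hB : ∀ i, MeasurableSet (B i)) {w : α → ℂ}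
    (hw : Integrable w μ) (S Q : Finset ι) :
    ‖∫ x in (⋂ i ∈ S, B i) ∩ ⋂ i ∈ Q, (B i)ᶜ, w x ∂μ‖ ≤
      ∑ Q' ∈ Q.powerset, ‖∫ x in ⋂ i ∈ S ∪ Q', B i, w x ∂μ‖ := by
  induction Q using Finset.induction_on generalizing S with
  | empty => simp
  | @insert q Q hq ih =>
    have hE : MeasurableSet ((⋂ i ∈ S, B i) ∩ ⋂ i ∈ Q, (B i)ᶜ) :=
      (S.measurableSet_biInter fun i _ => hB i).inter (Q.measurableSet_biInter fun i _ => (hB i).compl)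
    -- split off the new good plaquette `q`
    have hset : ((⋂ i ∈ S, B i) ∩ ⋂ i ∈ insert q Q, (B i)ᶜ) =
        ((⋂ i ∈ S, B i) ∩ ⋂ i ∈ Q, (B i)ᶜ) \ (((⋂ i ∈ S, B i) ∩ ⋂ i ∈ Q, (B i)ᶜ) ∩ B q) := by
      rw [Set.sdiff_self_inter]
      ext x
      simp only [Finset.set_biInter_insert, Set.mem_inter_iff, Set.mem_sdiff, Set.mem_compl_iff]
      tauto
    have hsub : ((⋂ i ∈ S, B i) ∩ ⋂ i ∈ Q, (B i)ᶜ) ∩ B q ⊆ (⋂ i ∈ S, B i) ∩ ⋂ i ∈ Q, (B i)ᶜ :=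
      Set.inter_subset_left
    have hins : ((⋂ i ∈ S, B i) ∩ ⋂ i ∈ Q, (B i)ᶜ) ∩ B q = (⋂ i ∈ insert q S, B i) ∩ ⋂ i ∈ Q, (B i)ᶜ := by
      ext x
      simp only [Finset.set_biInter_insert, Set.mem_inter_iff]
      tauto
    rw [hset, setIntegral_sdiff (hE.inter (hB q)) hw.integrableOn hsub, hins, Finset.sum_powerset_insert hq]
    refine (norm_sub_le _ _).trans (add_le_add (ih S) ?_)
    refine (ih (insert q S)).trans (le_of_eq (Finset.sum_congr rfl fun Q' _ => ?_))
    rw [Finset.insert_union, Finset.union_insert]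

/-! ## Continuity of the antiperiodic determinant and measurability of the deficit -/

/-- The antiperiodic Wilson–Dirac determinant `U ↦ det D_AP[U, m]` (route inlining of the `U(3)` lift with the
seam signs) is continuous in the `SU(3)` field. [folklore] -/
-- adapted from Theorems/QuarksAsStableActionUnquenchedChessboardBoundHeavyFloor.lean (continuous_apLift etc.)
theorem continuous_apDet {L : ℕ} [NeZero L] (m : ℝ) :
    Continuous fun U : GaugeConfig 4 L (Matrix.specialUnitaryGroup (Fin 3) ℂ) =>
      fermionDet (wilsonDirac (unitaryFundamentalRep (Fin 3) ℂ)
        (fun e => if e.1 e.2 = -1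
          then -(⟨(U e).1, Matrix.specialUnitaryGroup_le_unitaryGroup (U e).2⟩ :
            Matrix.unitaryGroup (Fin 3) ℂ)
          else ⟨(U e).1, Matrix.specialUnitaryGroup_le_unitaryGroup (U e).2⟩) m 1) := by
  have hρ : Continuous (unitaryFundamentalRep (Fin 3) ℂ) := continuous_subtype_val
  have hD := continuous_wilsonDirac (L := L) (unitaryFundamentalRep (Fin 3) ℂ) hρ m 1
  have hlift : Continuous fun U : GaugeConfig 4 L (Matrix.specialUnitaryGroup (Fin 3) ℂ) =>
      (fun e => if e.1 e.2 = -1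
        then -(⟨(U e).1, Matrix.specialUnitaryGroup_le_unitaryGroup (U e).2⟩ :
          Matrix.unitaryGroup (Fin 3) ℂ)
        else ⟨(U e).1, Matrix.specialUnitaryGroup_le_unitaryGroup (U e).2⟩ :
          GaugeConfig 4 L (Matrix.unitaryGroup (Fin 3) ℂ)) := by
    refine continuous_pi fun e => ?_
    have hincl : Continuous fun U : GaugeConfig 4 L (Matrix.specialUnitaryGroup (Fin 3) ℂ) =>
        (⟨(U e).1, Matrix.specialUnitaryGroup_le_unitaryGroup (U e).2⟩ : Matrix.unitaryGroup (Fin 3) ℂ) :=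
      (continuous_subtype_val.comp (continuous_apply e)).subtype_mk _
    by_cases h : e.1 e.2 = -1
    · simp only [h, if_true]
      exact ((continuous_subtype_val.neg).subtype_mk _).comp hincl
    · simp only [h, if_false]
      exact hincl
  exact (hD.comp hlift).matrix_det

/-- The plaquette deficit `U ↦ 3 − Re tr U_p` is continuous in the `SU(3)` field. [folklore] -/
theorem continuous_dfc {L : ℕ} (p : Plaquette 4 L) :
    Continuous fun U : GaugeConfig 4 L (Matrix.specialUnitaryGroup (Fin 3) ℂ) =>
      3 - (fundamentalRep (Fin 3) (plaquetteHolonomy U p.1 p.2.1.1 p.2.1.2)).trace.re := by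
  have h1 : Continuous fun U : GaugeConfig 4 L (Matrix.specialUnitaryGroup (Fin 3) ℂ) =>
      plaquetteHolonomy U p.1 p.2.1.1 p.2.1.2 := by
    unfold plaquetteHolonomy; fun_prop
  exact continuous_const.sub
    (Complex.continuous_re.comp ((continuous_fundamentalRep (Fin 3)).comp h1).matrix_trace)

/-! ## The exact-pattern bound over the route's objects -/

/-- **Exact-pattern (signed Peierls) bound from the chessboard bound.**  `UnquenchedChessboardBound` implies: for
every `N_f`, mass window `[m_lo, m_hi]` with `m_lo > −1` and `δ > 0` there are `C ≥ 0`, `c > 0`, `β₀` such that for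
all `β ≥ β₀`, all even `L ≥ 4`, all masses in the window and ALL finite sets `S`, `Q` of plaquettes,
`‖∫_{S all δ-bad, Q all δ-good} ∏_f det D_AP dμ_W / ∫ ∏_f det D_AP dμ_W‖ ≤ (C e^{−cβ})^{|S|} (1 + C e^{−cβ})^{|Q|}`:
mixed bad/good patterns of the SIGNED unquenched functional are exponentially small in the number of bad
plaquettes at the cost `(1 + C e^{−cβ})` per required good plaquette — the input of the exact-cluster (contour)
representation of the dislocation gas.  CONDITIONAL on `UnquenchedChessboardBound` (item stmt-QuantumFields-9735,
open), taken as the hypothesis. -/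
theorem exact_pattern_bound_of_unquenchedChessboardBound :
    UnquenchedChessboardBound → ∀ (Nf : ℕ) (mlo mhi δ : ℝ), -1 < mlo → 0 < δ → ∃ C c β₀ : ℝ, 0 < c ∧ 0 ≤ C ∧
      ∀ β : ℝ, β₀ ≤ β → ∀ (L : ℕ) [NeZero L], Even L → 4 ≤ L →
        let apDet : GaugeConfig 4 L (Matrix.specialUnitaryGroup (Fin 3) ℂ) → ℝ → ℂ := fun U m =>
          fermionDet (wilsonDirac (unitaryFundamentalRep (Fin 3) ℂ)
            (fun e => if e.1 e.2 = -1
              then -(⟨(U e).1, Matrix.specialUnitaryGroup_le_unitaryGroup (U e).2⟩ :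
                Matrix.unitaryGroup (Fin 3) ℂ)
              else ⟨(U e).1, Matrix.specialUnitaryGroup_le_unitaryGroup (U e).2⟩) m 1);
        let dfc : GaugeConfig 4 L (Matrix.specialUnitaryGroup (Fin 3) ℂ) → Plaquette 4 L → ℝ := fun U p =>
          3 - (fundamentalRep (Fin 3) (plaquetteHolonomy U p.1 p.2.1.1 p.2.1.2)).trace.re;
        ∀ m : Fin Nf → ℝ, (∀ f, mlo ≤ m f ∧ m f ≤ mhi) →
          ∀ S Q : Finset (Plaquette 4 L),
            ‖(∫ U in {U | (∀ q ∈ S, δ ≤ dfc U q) ∧ ∀ q ∈ Q, dfc U q < δ}, (∏ f, apDet U (m f))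
                  ∂(wilsonMeasure (d := 4) (L := L) (fundamentalRep (Fin 3)) β)) /
                (∫ U, (∏ f, apDet U (m f))
                  ∂(wilsonMeasure (d := 4) (L := L) (fundamentalRep (Fin 3)) β))‖ ≤
              (C * Real.exp (-c * β)) ^ S.card * (1 + C * Real.exp (-c * β)) ^ Q.card := by
  intro hA Nf mlo mhi δ hmlo hδ
  obtain ⟨C₀, c, β₀, hc, h⟩ := hA Nf mlo mhi δ hmlo hδ
  refine ⟨|C₀|, c, β₀, hc, abs_nonneg _, fun β hβ L _ hEven hL => ?_⟩
  intro apDet dfc m hm S Q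
  set μW : Measure (GaugeConfig 4 L (Matrix.specialUnitaryGroup (Fin 3) ℂ)) :=
    wilsonMeasure (d := 4) (L := L) (fundamentalRep (Fin 3)) β with hμW
  set t : ℝ := |C₀| * Real.exp (-c * β) with ht
  have ht0 : 0 ≤ t := mul_nonneg (abs_nonneg _) (Real.exp_pos _).le
  -- the empty pattern: `S` and `Q` meet
  by_cases hSQ : Disjoint S Q
  swap
  · have hempty : {U : GaugeConfig 4 L (Matrix.specialUnitaryGroup (Fin 3) ℂ) |
        (∀ q ∈ S, δ ≤ dfc U q) ∧ ∀ q ∈ Q, dfc U q < δ} = ∅ := by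
      obtain ⟨q, hqS, hqQ⟩ := Finset.not_disjoint_iff.mp hSQ
      ext U
      simp only [Set.mem_setOf_eq, Set.mem_empty_iff_false, iff_false, not_and]
      intro h1 h2
      exact absurd (h1 q hqS) (not_le.mpr (h2 q hqQ))
    rw [hempty, Measure.restrict_empty, integral_zero_measure, zero_div, norm_zero]
    positivity
  -- A, with `C₀` replaced by `|C₀|`
  have hAR : ∀ R : Finset (Plaquette 4 L),
      ‖(∫ U in {U | ∀ q ∈ R, δ ≤ dfc U q}, (∏ f, apDet U (m f)) ∂μW) /
          (∫ U, (∏ f, apDet U (m f)) ∂μW)‖ ≤ t ^ R.card := by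
    intro R
    refine (h β hβ L hEven hL m hm R).trans ?_
    calc (C₀ * Real.exp (-c * β)) ^ R.card ≤ |(C₀ * Real.exp (-c * β)) ^ R.card| := le_abs_self _
      _ = t ^ R.card := by rw [abs_pow, abs_mul, abs_of_pos (Real.exp_pos _)]
  -- the bad events and the weight
  set B : Plaquette 4 L → Set (GaugeConfig 4 L (Matrix.specialUnitaryGroup (Fin 3) ℂ)) :=
    fun q => {U | δ ≤ dfc U q} with hB
  haveI : SecondCountableTopology (Matrix (Fin 3) (Fin 3) ℂ) :=
    inferInstanceAs (SecondCountableTopology (Fin 3 → Fin 3 → ℂ))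
  haveI : SecondCountableTopology (Matrix.specialUnitaryGroup (Fin 3) ℂ) :=
    Topology.IsEmbedding.subtypeVal.secondCountableTopology
  have hBm : ∀ q, MeasurableSet (B q) := fun q =>
    measurableSet_le measurable_const (continuous_dfc q).measurable
  have hwc : Continuous fun U : GaugeConfig 4 L (Matrix.specialUnitaryGroup (Fin 3) ℂ) =>
      ∏ f, apDet U (m f) :=
    continuous_finsetProd _ fun f _ => continuous_apDet (m f)
  have hw : Integrable (fun U => ∏ f, apDet U (m f)) μW := by
    obtain ⟨U₀, -, hU₀⟩ :=
      (isCompact_univ (X := GaugeConfig 4 L (Matrix.specialUnitaryGroup (Fin 3) ℂ))).exists_isMaxOn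
        Set.univ_nonempty hwc.norm.continuousOn
    exact Integrable.of_bound hwc.measurable.aestronglyMeasurable ‖∏ f, apDet U₀ (m f)‖
      (Filter.Eventually.of_forall fun U => hU₀ (Set.mem_univ U))
  -- the events as intersections
  have hEv : {U : GaugeConfig 4 L (Matrix.specialUnitaryGroup (Fin 3) ℂ) |
      (∀ q ∈ S, δ ≤ dfc U q) ∧ ∀ q ∈ Q, dfc U q < δ} = (⋂ q ∈ S, B q) ∩ ⋂ q ∈ Q, (B q)ᶜ := by
    ext U
    simp only [hB, Set.mem_setOf_eq, Set.mem_inter_iff, Set.mem_iInter, Set.mem_compl_iff, not_le]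
  have hEv' : ∀ R : Finset (Plaquette 4 L),
      (⋂ q ∈ R, B q) = {U : GaugeConfig 4 L (Matrix.specialUnitaryGroup (Fin 3) ℂ) | ∀ q ∈ R, δ ≤ dfc U q} := by
    intro R
    ext U
    simp only [hB, Set.mem_setOf_eq, Set.mem_iInter]
  -- the normalisation
  by_cases hZ : ∫ U, (∏ f, apDet U (m f)) ∂μW = 0
  · rw [hZ, div_zero, norm_zero]
    positivity
  have hZpos : 0 < ‖∫ U, (∏ f, apDet U (m f)) ∂μW‖ := norm_pos_iff.mpr hZ
  have hterm : ∀ Q' ∈ Q.powerset,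
      ‖∫ U in ⋂ q ∈ S ∪ Q', B q, (∏ f, apDet U (m f)) ∂μW‖ ≤
        t ^ S.card * t ^ Q'.card * ‖∫ U, (∏ f, apDet U (m f)) ∂μW‖ := by
    intro Q' hQ'
    have hdisj : Disjoint S Q' := hSQ.mono_right (Finset.mem_powerset.mp hQ')
    have hcard : (S ∪ Q').card = S.card + Q'.card := Finset.card_union_of_disjoint hdisj
    have hx := hAR (S ∪ Q')
    rw [← hEv' (S ∪ Q'), norm_div, div_le_iff₀ hZpos, hcard, pow_add] at hx
    exact hx
  rw [norm_div, div_le_iff₀ hZpos, hEv]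
  calc ‖∫ U in (⋂ q ∈ S, B q) ∩ ⋂ q ∈ Q, (B q)ᶜ, (∏ f, apDet U (m f)) ∂μW‖
      ≤ ∑ Q' ∈ Q.powerset, ‖∫ U in ⋂ q ∈ S ∪ Q', B q, (∏ f, apDet U (m f)) ∂μW‖ :=
        norm_setIntegral_biInter_inter_biInter_compl_le B hBm hw S Q
    _ ≤ ∑ Q' ∈ Q.powerset, t ^ S.card * t ^ Q'.card * ‖∫ U, (∏ f, apDet U (m f)) ∂μW‖ :=
        Finset.sum_le_sum hterm
    _ = t ^ S.card * (∑ Q' ∈ Q.powerset, t ^ Q'.card * 1 ^ (Q.card - Q'.card)) *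
          ‖∫ U, (∏ f, apDet U (m f)) ∂μW‖ := by
        rw [Finset.mul_sum, Finset.sum_mul]
        refine Finset.sum_congr rfl fun Q' _ => ?_
        rw [one_pow, mul_one]
    _ = t ^ S.card * (1 + t) ^ Q.card * ‖∫ U, (∏ f, apDet U (m f)) ∂μW‖ := by
        rw [Finset.sum_pow_mul_eq_add_pow, add_comm t 1]

/-! ## The exact-cluster size tail (appended) -/

/-- The outer `G`-boundary of a finite vertex set has at most `Δ · |S|` elements when all degrees are `≤ Δ`.
[folklore] -/
theorem card_neighbor_sdiff_le {V : Type*} [Fintype V] [DecidableEq V] (G : SimpleGraph V) [DecidableRel G.Adj]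
    {Δ : ℕ} (hΔ : ∀ x, G.degree x ≤ Δ) (S : Finset V) :
    ((S.biUnion fun x => G.neighborFinset x) \ S).card ≤ Δ * S.card := by
  calc ((S.biUnion fun x => G.neighborFinset x) \ S).card
      ≤ (S.biUnion fun x => G.neighborFinset x).card := Finset.card_le_card Finset.sdiff_subset
    _ ≤ ∑ x ∈ S, (G.neighborFinset x).card := Finset.card_biUnion_le
    _ ≤ ∑ _x ∈ S, Δ := Finset.sum_le_sum fun x _ => (G.card_neighborFinset_eq_degree x).le.trans (hΔ x)
    _ = Δ * S.card := by rw [Finset.sum_const, smul_eq_mul, mul_comm]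

/-- Counting: `Δ^{2(n-1)} ≤ (Δ+1)^{2n}` in `ℝ`. -/
private theorem pow_animal_le' (Δ n : ℕ) : ((Δ ^ (2 * (n - 1)) : ℕ) : ℝ) ≤ ((Δ : ℝ) + 1) ^ (2 * n) := by
  have h1 : (Δ : ℝ) ^ (2 * (n - 1)) ≤ ((Δ : ℝ) + 1) ^ (2 * (n - 1)) :=
    pow_le_pow_left₀ (Nat.cast_nonneg Δ) (by linarith) _
  have h2 : ((Δ : ℝ) + 1) ^ (2 * (n - 1)) ≤ ((Δ : ℝ) + 1) ^ (2 * n) :=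
    pow_le_pow_right₀ (by linarith [(Nat.cast_nonneg Δ : (0 : ℝ) ≤ Δ)]) (by omega)
  push_cast
  exact h1.trans h2

/-- **Exact-cluster sum from the chessboard bound.**  `UnquenchedChessboardBound` implies: for every `N_f`, mass
window `[m_lo, m_hi]` with `m_lo > −1` and `δ > 0` there are `C ≥ 0`, `c > 0`, `β₀` such that for all `β ≥ β₀`, all
even `L ≥ 4`, all masses in the window, EVERY plaquette graph `G` with degrees `≤ Δ`, every plaquette `p`, every `n`
and every family `𝒜` of `G`-connected `n`-sets of plaquettes through `p`,
`Σ_{S ∈ 𝒜} ‖∫_{S all δ-bad, ∂_G S all δ-good} ∏_f det D_AP dμ_W / ∫ ∏_f det D_AP dμ_W‖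
  ≤ (Δ+1)^{2n} (C e^{−cβ})ⁿ (1 + C e^{−cβ})^{Δ n}`,
where `∂_G S = (⋃_{x ∈ S} N_G(x)) ∖ S`: the activities of the EXACT bad clusters of the signed unquenched functional
have an exponential size tail, uniformly in the volume.  CONDITIONAL on `UnquenchedChessboardBound`
(item stmt-QuantumFields-9735, open), taken as the hypothesis. -/
theorem exact_cluster_sum_of_unquenchedChessboardBound :
    UnquenchedChessboardBound → ∀ (Nf : ℕ) (mlo mhi δ : ℝ), -1 < mlo → 0 < δ → ∃ C c β₀ : ℝ, 0 < c ∧ 0 ≤ C ∧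
      ∀ β : ℝ, β₀ ≤ β → ∀ (L : ℕ) [NeZero L], Even L → 4 ≤ L →
        let apDet : GaugeConfig 4 L (Matrix.specialUnitaryGroup (Fin 3) ℂ) → ℝ → ℂ := fun U m =>
          fermionDet (wilsonDirac (unitaryFundamentalRep (Fin 3) ℂ)
            (fun e => if e.1 e.2 = -1
              then -(⟨(U e).1, Matrix.specialUnitaryGroup_le_unitaryGroup (U e).2⟩ :
                Matrix.unitaryGroup (Fin 3) ℂ)
              else ⟨(U e).1, Matrix.specialUnitaryGroup_le_unitaryGroup (U e).2⟩) m 1);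
        let dfc : GaugeConfig 4 L (Matrix.specialUnitaryGroup (Fin 3) ℂ) → Plaquette 4 L → ℝ := fun U p =>
          3 - (fundamentalRep (Fin 3) (plaquetteHolonomy U p.1 p.2.1.1 p.2.1.2)).trace.re;
        ∀ m : Fin Nf → ℝ, (∀ f, mlo ≤ m f ∧ m f ≤ mhi) →
          ∀ (G : SimpleGraph (Plaquette 4 L)) [DecidableRel G.Adj] (Δ : ℕ), (∀ x, G.degree x ≤ Δ) →
            ∀ (p : Plaquette 4 L) (n : ℕ) (𝒜 : Finset (Finset (Plaquette 4 L))),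
              (∀ S ∈ 𝒜, p ∈ S ∧ S.card = n ∧ IsGraphConnected G S) →
                ∑ S ∈ 𝒜, ‖(∫ U in {U | (∀ q ∈ S, δ ≤ dfc U q) ∧
                      ∀ q ∈ (S.biUnion fun x => G.neighborFinset x) \ S, dfc U q < δ}, (∏ f, apDet U (m f))
                      ∂(wilsonMeasure (d := 4) (L := L) (fundamentalRep (Fin 3)) β)) /
                    (∫ U, (∏ f, apDet U (m f))
                      ∂(wilsonMeasure (d := 4) (L := L) (fundamentalRep (Fin 3)) β))‖ ≤
                  ((Δ : ℝ) + 1) ^ (2 * n) * (C * Real.exp (-c * β)) ^ n *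
                    (1 + C * Real.exp (-c * β)) ^ (Δ * n) := by
  intro hA Nf mlo mhi δ hmlo hδ
  obtain ⟨C, c, β₀, hc, hC, h⟩ := exact_pattern_bound_of_unquenchedChessboardBound hA Nf mlo mhi δ hmlo hδ
  refine ⟨C, c, β₀, hc, hC, fun β hβ L _ hEven hL => ?_⟩
  intro apDet dfc m hm G _ Δ hΔ p n 𝒜 h𝒜
  set t : ℝ := C * Real.exp (-c * β) with ht
  have ht0 : 0 ≤ t := mul_nonneg hC (Real.exp_pos _).le
  have ht1 : 1 ≤ 1 + t := le_add_of_nonneg_right ht0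
  -- each exact-cluster activity is bounded by the exact-pattern bound
  have hterm : ∀ S ∈ 𝒜,
      ‖(∫ U in {U | (∀ q ∈ S, δ ≤ dfc U q) ∧
            ∀ q ∈ (S.biUnion fun x => G.neighborFinset x) \ S, dfc U q < δ}, (∏ f, apDet U (m f))
            ∂(wilsonMeasure (d := 4) (L := L) (fundamentalRep (Fin 3)) β)) /
          (∫ U, (∏ f, apDet U (m f))
            ∂(wilsonMeasure (d := 4) (L := L) (fundamentalRep (Fin 3)) β))‖ ≤
        t ^ n * (1 + t) ^ (Δ * n) := by
    intro S hS
    have hx := h β hβ L hEven hL m hm S ((S.biUnion fun x => G.neighborFinset x) \ S)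
    rw [(h𝒜 S hS).2.1] at hx
    refine hx.trans (mul_le_mul_of_nonneg_left ?_ (pow_nonneg ht0 n))
    refine pow_le_pow_right₀ ht1 ?_
    rw [← (h𝒜 S hS).2.1]
    exact card_neighbor_sdiff_le G hΔ S
  -- the number of connected `n`-sets through `p` is at most `Δ^{2(n-1)}`
  have hcard : 𝒜.card ≤ Δ ^ (2 * (n - 1)) := card_le_pow_of_isGraphConnected hΔ 𝒜 h𝒜
  have hx : 0 ≤ t ^ n * (1 + t) ^ (Δ * n) := by positivity
  calc ∑ S ∈ 𝒜, ‖(∫ U in {U | (∀ q ∈ S, δ ≤ dfc U q) ∧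
            ∀ q ∈ (S.biUnion fun x => G.neighborFinset x) \ S, dfc U q < δ}, (∏ f, apDet U (m f))
            ∂(wilsonMeasure (d := 4) (L := L) (fundamentalRep (Fin 3)) β)) /
          (∫ U, (∏ f, apDet U (m f)) ∂(wilsonMeasure (d := 4) (L := L) (fundamentalRep (Fin 3)) β))‖
      ≤ ∑ _S ∈ 𝒜, t ^ n * (1 + t) ^ (Δ * n) := Finset.sum_le_sum hterm
    _ = (𝒜.card : ℝ) * (t ^ n * (1 + t) ^ (Δ * n)) := by rw [Finset.sum_const, nsmul_eq_mul]
    _ ≤ ((Δ ^ (2 * (n - 1)) : ℕ) : ℝ) * (t ^ n * (1 + t) ^ (Δ * n)) :=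
        mul_le_mul_of_nonneg_right (by exact_mod_cast hcard) hx
    _ ≤ ((Δ : ℝ) + 1) ^ (2 * n) * (t ^ n * (1 + t) ^ (Δ * n)) :=
        mul_le_mul_of_nonneg_right (pow_animal_le' Δ n) hx
    _ = ((Δ : ℝ) + 1) ^ (2 * n) * t ^ n * (1 + t) ^ (Δ * n) := by ring

end Summit.QuantumFields.QCD.Cruxes.StableActionBridge.Sketch
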